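import Summits.BirchSwinnertonDyer.BirchSwinnertonDyer.Theorems.SignedLowerHalvesKobayashiMainConjectureSmallImageLambdaTransferCM25RecordsA
import Summits.BirchSwinnertonDyer.Rank1Residual.Supersingular.SignedRankOneCorA5
import HarnessLib

/-!
# Route `SignedLowerHalves`, crux `KobayashiMainConjectureSmallImage` (item stmt-BirchSwinnertonDyer-19002):
# small-image congruence road («L4-λ») — RECORDS «L4LAM-r2» part D: the `BSD(E,3)` door at 380894f1 @ 3 (cell `bsd-ssimc`, seat `bsd-ssimc-k3-c4` gen 9;
# planner D28-7 (c); a `--supports stmt-BirchSwinnertonDyer-19002 --as helper` file; closes nothing about the crux)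

PARTITION (cell bsd-ssimc): X7 (A7) × the pair `380894f1 @ 3` — per-pair record (`BSD(E,3)` from the landed per-pair signed main
conjecture of part A through the IMAGE-FREE rank-one road); the crux `KobayashiMainConjectureSmallImage` stays OPEN; 0 census moves
are booked here (desk keys are the planner's to file); BSD is not proved by any of this. THEOREMS ONLY.

## What this part adds to part A (`…LambdaTransferCM25RecordsA.lean`, p500636)

Part A landed `lam4_kobayashiMainConjecture_380894f1_3 : … → KobayashiMainConjecture W 3 ε` (either sign) for the OPEN desk cell
`380894f1 @ 3` (X7, `r_an = 1`, `N = 2 · 43² · 103`, `∏c = 36`, `#Ш_an = 1`; CM partner 1849a1, `3` inert in `ℚ(√−43)`; the `3`-congruence a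
KERNEL theorem by Fisher's Hesse pencil) by the small-image congruence road — NO `Surj`, NO `BSD(E,3)` input, NO preprint, NO `hMT`.
This part feeds that record into the class-X7 rank-one consumer
`Summit.BirchSwinnertonDyer.Rank1Residual.Supersingular.X7.bsdp_of_kobayashiMainConjecture_of_corA5_of_analyticRank_eq_one`
(`SignedRankOneCorA5.lean` §3, cell `b2b-bsdres`): Kobayashi's signed main conjecture for ONE sign + the Burungale–Kobayashi–Ota
Cor. A.5 reading-fact `hA5 : corA5_pPart_of_signedCharIdeal_eq` (PUBLISHED, J. Inst. Math. Jussieu 23 (2024) App. A, read at `a_p = 0`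
through Kobayashi 2003 Thm. 7.4; the fact carries referee R118's reading flags `BKO24-CorA5-IMC-unpinned` /
`BKO24-CorA5-proof-by-reference-Kob14` in its own docstring) + modularity `hmod'` + GZK `hGZK` ⇒ `BSDp W 3`. That road is IMAGE-FREE and
LEVEL-FREE (no `Surj`, no semistability, no Heegner hypothesis), which is exactly what a `3Nn`-image, non-semistable pair needs.
Class X7 at `3` (good supersingular at `3`, additive at `43`) and `a_3 = 0` are decided in the kernel from the Cremona model; the rank
datum `hr : W.analyticRank = 1` (Cremona) is DISPLAYED, as `hr : W.analyticRank = 0` is in parts B/C.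

NOT claimed: no main conjecture and no case of BSD is asserted outside the displayed binders; whether the desk prices `hA5` on this
cell is the planner's / referee A's word (it is the binder priced on every X7 `r_an = 1` MT-road key since R363); nothing is booked here.

References: [BurungaleKobayashiOta2023] App. A Cor. A.5; [Kobayashi2003] Thm. 7.4 (p. 13), Conj. (p. 2), Thm. 1.2, 4.1;
[BDKim2009] Cor. 2.13, 2.5, Prop. 2.6; [PollackRubin2004] Thm. (p. 448); [Pollack2003] Def. 6.15, Prop. 6.9/6.10/6.18;
[Fisher2012Hessian] Thm. 13.2, §13; [GreenbergVatsal2000] Prop. (2.4); [Miller2011LMS] §1, Def. 1.1; [Darmon2004] Thm. 3.22;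
[Cremona2006] Table 1; [SilvermanAEC2009] V §2, VII.5. Memo: `HOME/k3c4-MEMO-8.md` + addendum D.
-/

set_option autoImplicit false
set_option linter.dupNamespace false
noncomputable section

open scoped Classical MatrixGroups ModularForm BigOperators

open CongruenceSubgroup WeierstrassCurve NumberField IsDedekindDomain Rat.HeightOneSpectrum
  Literature.NumberTheory.EllipticCurves
  Literature.NumberTheory.EllipticCurves.ModularForms
  Literature.NumberTheory.EllipticCurves.Rank1Residual
  Literature.NumberTheory.EllipticCurves.Rank1Residual.Typed
  Literature.NumberTheory.EllipticCurves.Kobayashi2003 ZpExtension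
  Literature.NumberTheory.EllipticCurves.GreenbergVatsal2000
  Literature.NumberTheory.EllipticCurves.BDKim2009
  Literature.NumberTheory.EllipticCurves.Fisher2012
  Literature.NumberTheory.EllipticCurves.BurungaleKobayashiOta2024
  Literature.NumberTheory.EllipticCurves.Rank1Residual.X11RankOneCertificates
  Literature.NumberTheory.GaloisRepresentations
  Summit.BirchSwinnertonDyer.Rank1Residual.X1.MuLambda
  Summit.BirchSwinnertonDyer.Rank1Residual.Supersingular
  Summit.BirchSwinnertonDyer.Rank1Residual.X2.LocalDeltaCalculus
  Summit.BirchSwinnertonDyer.BirchSwinnertonDyer.Rank1Residual.IntModel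
  Summit.BirchSwinnertonDyer.BirchSwinnertonDyer.Rank1Residual.X11RankOne
  Summit.BirchSwinnertonDyer.Rank1Residual.X11b
  Summit.BirchSwinnertonDyer.Rank1Residual.X9
  Summit.BirchSwinnertonDyer.Rank1Residual.X1
  Summit.BirchSwinnertonDyer.BirchSwinnertonDyer.Theorems.CongruenceRoad

namespace Summit.BirchSwinnertonDyer.BirchSwinnertonDyer.Theorems.SmallImageCongruenceRoad

/-! ### §1 Class X7 at `3`, kernel-decided -/

/-- **`380894f1` is class X7 at `3`**: good supersingular at `3` (`3 ∤ Δ = −2⁶·43³·103³`, `#Ẽ(𝔽_3) = 4`, `a_3 = 0`) and NOT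
semistable (`43 ∣ Δ`, `43 ∣ c₄ = −16383 = −3·43·127`: additive at `43`), read off the Cremona model `[1, -1, 1, 341, 113339]`
in the kernel (`classX7_of_intModel`). [cite: SilvermanAEC2009, VII.5 Prop. 5.1 (a) and (c)] [cite: Cremona2006, Table 1 (Cremona label 380894f1)] -/
theorem classX7_380894f1_3 (W : WeierstrassCurve ℚ) [W.IsElliptic] [W.IsGloballyMinimal] [Fact (Nat.Prime 3)]
    (hW : W = ⟨1, -1, 1, 341, 113339⟩) : ClassX7 W 3 :=
  have hI : integralModelInt W = ⟨1, -1, 1, 341, 113339⟩ :=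
    integralModelInt_eq_of_map_eq _ (by rw [hW]; ext <;> simp [WeierstrassCurve.map])
  classX7_of_intModel 3 hI (by decide) card_lam25_380894f1_3 (by norm_num) 43 (by norm_num) (by decide) (by decide)

/-! ### §2 The record: `BSD(E,3)` through the image-free rank-one road -/

/-- **`BSD(E,3)` for `380894f1`** (X7, `r_an = 1`, image `3Nn`-type (normaliser of a non-split Cartan; CM partner 1849a1 by `ℚ(√−43)`);
desk cell `residue; [(3,'X7')]` (OPEN) on referee A's live state 1edf686acdce8117) **through the IMAGE-FREE rank-one road**
`X7.bsdp_of_kobayashiMainConjecture_of_corA5_of_analyticRank_eq_one` (Burungale–Kobayashi–Ota Cor. A.5 reading-fact `hA5`, modularity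
`hmod'`, GZK `hGZK`; no `Surj`, no semistability, no level or Heegner hypothesis) fed with part A's
`lam4_kobayashiMainConjecture_380894f1_3` for EITHER sign's displayed rows (ε = −1: E row θ₃ with λ = deg ω₃⁺ + 3, partner row θ₁ with
λ = deg ω₁⁺ + 1; ε = 1: E row θ₂ with λ = deg ω₂⁻ + 3, partner row θ₂ with λ = deg ω₂⁻ + 1 — engines B/T/A of kit j268836 and b2b
`engT_layers.tsv`, as recorded in part A); the rank datum `hr : r_an = 1` (Cremona) is displayed; class X7 and `a_3 = 0` decided in the
kernel. Published inputs BY NAME (`h12 h41 h5 h3 h09 hKim hPR hmod hPollack hA5 hmod' hGZK`). NO descent certificate, NO `BSDp` input,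
NO preprint, NO Mazur–Tate congruence `hMT`. PER PAIR; crux 4 stays OPEN; nothing booked; BSD is not proved by any of this.
[cite: BurungaleKobayashiOta2023, App. A Cor. A.5] [cite: Kobayashi2003, Thm. 7.4 (p. 13), Thm. 1.2, Thm. 4.1 and Conjecture (p. 2)]
[cite: BDKim2009, Cor. 2.13, Cor. 2.5 and Prop. 2.6 (pp. 185–187)] [cite: PollackRubin2004, Theorem (p. 448) = Thm. 7.3]
[cite: Fisher2012Hessian, Thm. 13.2 and §13] [cite: Miller2011LMS, §1 and Def. 1.1] [cite: Darmon2004, Thm. 3.22]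
[cite: Cremona2006, Table 1 (Cremona label 380894f1)] -/
theorem lam4_bsdp_380894f1_3
    (h12 : Kobayashi2003.thm12_signedSelmerDual_finite_torsion)
    (h41 : Kobayashi2003.thm41_signedCharIdeal_divisibility)
    (h5 : realPeriodRat_eq_unit_mul_plusPeriod) (h3 : realPeriodRat_eq_unit_mul_plusPeriod_three)
    (h09 : cor213_signedMu_eq_zero_iff_of_torsionIso)
    (hKim : BDKim2009.cor213_signedLambda_add_sum_delta_eq_of_torsionIso)
    (hPR : PollackRubin2004.mainTheorem_signedCharIdeal_eq_of_cm)
    (hmod : nonempty_modularParametrizationData)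
    (hA5 : corA5_pPart_of_signedCharIdeal_eq) (hmod' : hasEntireLFunction_rat)
    (hGZK : rank_eq_analyticRank_of_analyticRank_le_one)
    (W A : WeierstrassCurve ℚ) [W.IsElliptic] [W.IsGloballyMinimal] [A.IsElliptic] [A.IsGloballyMinimal]
    [Fact (Nat.Prime 3)] (hW : W = ⟨1, -1, 1, 341, 113339⟩) (hA : A = ⟨0, 0, 1, -860, 9707⟩)
    (hr : W.analyticRank = 1)
    (hPollack : ∀ {N : ℕ} [NeZero N] {f : CuspForm (Gamma0 N) 2},
      pollack_exists_plusMinusPAdicLFunction (W := A) (f := f) (p := 3))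
    [NeZero (W.conductorNorm ℤ)] {f₀ : CuspForm (Gamma0 (W.conductorNorm ℤ)) 2} (hf₀ : IsNewformOf W f₀)
    [NeZero (A.conductorNorm ℤ)] {f₀' : CuspForm (Gamma0 (A.conductorNorm ℤ)) 2} (hf₀' : IsNewformOf A f₀')
    (ε : ℤˣ) {Θ Θ' : IwasawaAlgebra 3} (hΘ0 : Θ ≠ 0) (hμ : mu Θ = 0) (hΘ'0 : Θ' ≠ 0) (hμ' : mu Θ' = 0)
    (hrow : (ε = -1 ∧
        iwasawaToPowerSeries 3 Θ = ((mazurTateElement f₀ 3 3).map (algebraMap ℚ ℚ_[3]) : PowerSeries ℚ_[3]) ∧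
        lam Θ = (cyclotomicOmegaPlus 3 3).natDegree + 3 ∧
        iwasawaToPowerSeries 3 Θ' = ((mazurTateElement f₀' 3 1).map (algebraMap ℚ ℚ_[3]) : PowerSeries ℚ_[3]) ∧
        lam Θ' = (cyclotomicOmegaPlus 3 1).natDegree + 1) ∨
      (ε = 1 ∧
        iwasawaToPowerSeries 3 Θ = ((mazurTateElement f₀ 3 2).map (algebraMap ℚ ℚ_[3]) : PowerSeries ℚ_[3]) ∧
        lam Θ = (cyclotomicOmegaMinus 3 2).natDegree + 3 ∧
        iwasawaToPowerSeries 3 Θ' = ((mazurTateElement f₀' 3 2).map (algebraMap ℚ ℚ_[3]) : PowerSeries ℚ_[3]) ∧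
        lam Θ' = (cyclotomicOmegaMinus 3 2).natDegree + 1)) :
    BSDp W 3 := by
  have hI : integralModelInt W = ⟨1, -1, 1, 341, 113339⟩ :=
    integralModelInt_eq_of_map_eq _ (by rw [hW]; ext <;> simp [WeierstrassCurve.map])
  have hp2 : (3 : ℕ) ≠ 2 := by decide
  have hX : ClassX7 W 3 := classX7_380894f1_3 W hW
  have hap : W.frobeniusTrace 3 = 0 := by rw [frobeniusTrace_eq hI card_lam25_380894f1_3]; norm_num
  exact Summit.BirchSwinnertonDyer.Rank1Residual.Supersingular.X7.bsdp_of_kobayashiMainConjecture_of_corA5_of_analyticRank_eq_one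
    W 3 hA5 hmod' hGZK hp2 hX hap hr ε
    (lam4_kobayashiMainConjecture_380894f1_3 h12 h41 h5 h3 h09 hKim hPR hmod W A hW hA hPollack hf₀ hf₀' ε
      hΘ0 hμ hΘ'0 hμ' hrow)

/-- **`BSD(E,3)` for `380894f1` from the `ε = −1` rows alone** (the odd layer: E row θ₃, partner row θ₁ — the shape of parts B/C's
`lam4_bsdp_…_5`), a named specialisation of `lam4_bsdp_380894f1_3` for the desk key. PER PAIR; nothing booked; BSD is not proved by any
of this. [cite: BurungaleKobayashiOta2023, App. A Cor. A.5] [cite: Kobayashi2003, Thm. 7.4 (p. 13) and Conjecture (p. 2)]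
[cite: BDKim2009, Cor. 2.13 (p. 187)] [cite: Miller2011LMS, §1 and Def. 1.1] [cite: Cremona2006, Table 1 (Cremona label 380894f1)] -/
theorem lam4_bsdp_380894f1_3_of_odd_rows
    (h12 : Kobayashi2003.thm12_signedSelmerDual_finite_torsion)
    (h41 : Kobayashi2003.thm41_signedCharIdeal_divisibility)
    (h5 : realPeriodRat_eq_unit_mul_plusPeriod) (h3 : realPeriodRat_eq_unit_mul_plusPeriod_three)
    (h09 : cor213_signedMu_eq_zero_iff_of_torsionIso)
    (hKim : BDKim2009.cor213_signedLambda_add_sum_delta_eq_of_torsionIso)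
    (hPR : PollackRubin2004.mainTheorem_signedCharIdeal_eq_of_cm)
    (hmod : nonempty_modularParametrizationData)
    (hA5 : corA5_pPart_of_signedCharIdeal_eq) (hmod' : hasEntireLFunction_rat)
    (hGZK : rank_eq_analyticRank_of_analyticRank_le_one)
    (W A : WeierstrassCurve ℚ) [W.IsElliptic] [W.IsGloballyMinimal] [A.IsElliptic] [A.IsGloballyMinimal]
    [Fact (Nat.Prime 3)] (hW : W = ⟨1, -1, 1, 341, 113339⟩) (hA : A = ⟨0, 0, 1, -860, 9707⟩)
    (hr : W.analyticRank = 1)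
    (hPollack : ∀ {N : ℕ} [NeZero N] {f : CuspForm (Gamma0 N) 2},
      pollack_exists_plusMinusPAdicLFunction (W := A) (f := f) (p := 3))
    [NeZero (W.conductorNorm ℤ)] {f₀ : CuspForm (Gamma0 (W.conductorNorm ℤ)) 2} (hf₀ : IsNewformOf W f₀)
    [NeZero (A.conductorNorm ℤ)] {f₀' : CuspForm (Gamma0 (A.conductorNorm ℤ)) 2} (hf₀' : IsNewformOf A f₀')
    {Θ Θ' : IwasawaAlgebra 3}
    (hΘ : iwasawaToPowerSeries 3 Θ = ((mazurTateElement f₀ 3 3).map (algebraMap ℚ ℚ_[3]) : PowerSeries ℚ_[3]))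
    (hΘ0 : Θ ≠ 0) (hμ : mu Θ = 0) (hlam : lam Θ = (cyclotomicOmegaPlus 3 3).natDegree + 3)
    (hΘ' : iwasawaToPowerSeries 3 Θ' = ((mazurTateElement f₀' 3 1).map (algebraMap ℚ ℚ_[3]) : PowerSeries ℚ_[3]))
    (hΘ'0 : Θ' ≠ 0) (hμ' : mu Θ' = 0) (hlam' : lam Θ' = (cyclotomicOmegaPlus 3 1).natDegree + 1) :
    BSDp W 3 :=
  lam4_bsdp_380894f1_3 h12 h41 h5 h3 h09 hKim hPR hmod hA5 hmod' hGZK W A hW hA hr hPollack hf₀ hf₀' (-1) hΘ0 hμ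
    hΘ'0 hμ' (Or.inl ⟨rfl, hΘ, hlam, hΘ', hlam'⟩)

end Summit.BirchSwinnertonDyer.BirchSwinnertonDyer.Theorems.SmallImageCongruenceRoad

end
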